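import Summits.QuantumFields.BalabanUV.T4Continuum.Support.NE3CovariantLineSumsTower
import HarnessLib

/-!
# T⁴ programme, node NE3, route Π (Γ′) · γ4′a-CORE (file A) — THE LINEARISED DOUBLE-BAR TOWER IS DOMINATED BY A POSITIVE
# MAJORANT TOWER: `‖Y(b)‖ ≤ ω(b)` everywhere ⇒ `‖QbarIter L (j+1) W Y (z,κ)‖ ≤ majIter d L (j+1) x ω (z,κ)`

NE3 formalisation swarm `b2b-balaban-t4-ne3-formalise-*`, LEAF PROVER 04 (gen 8), OFFER «γ4′a-core» to the Π-C-3γ holder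
(`leaf-02-g8`, design note `HOME/t4/b2b-balaban-t4-ne3-formalise-leaf-02/g8/D-ne3leaf02g8-1.md` §2, item γ4′a (iii): «`Qbar` as a
TRANSVERSE AVERAGE OF LINE SUMS + curvature … the one new structural input of the route»; journal HOME/CLAIMS.log l.24945).

THE POINT.  The k-fold linearised double-bar average `QbarIter` (this lineage's `NE3TangentCovariantTower`) is, level by level,
the straight covariant block-line average `Qstr = Ad_{V̄⁻¹} segMain` plus a defect of relative size `16(d+1)(d+4)L²a` in the LOCAL
`ℓ¹` weights (`NE3CovariantLineSums.norm_Qbar_sub_Qstr_le`, leaf-04 g4; `BlockAverageDbarLinBound.norm_segMain_le`, leaf-10).  Both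
bounds are POSITIVE LINEAR FUNCTIONALS of the bond sizes `‖Y(b)‖`: the block average of the `L` straight `κ`-segment `ℓ¹`'s (so ONE
spiked bond on one of the `L^{d−1}` lines of the block enters with weight `≤ L^{1−d}` — the transverse dilution) and the loop ∕ tree ∕
segment `ℓ¹`'s of the double block.  Hence, for ANY real bond weight `ω` with `‖Y(b)‖ ≤ ω(b)`, the tower is dominated POINTWISE by the
tower of positive operators `ω ↦ segStep L ω + wlin d L xᵢ · locStep L ω` (radii `xᵢ = (prop1Radius d L)^[i] x` of the multi-level
small-field class, inner-first like `QbarIter`) applied to `ω` — with NO constant and NO choice of currency.  The evaluation of this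
majorant tower on the two-tier class (bulk `m` + corner spikes `a·(1+r)^{1−d}`) with a k-FREE constant is file B (`NE3QbarIterTwoTier`).

CONTENT (all [folklore]; 0 sorry; real-valued DATA defs `lsum`, `segW`, `loopW`, `treeW'`, `locW`, `segStep`, `locStep`, `wlin`,
`stepMaj`, `majIter` → async audit):
* §1 word weights on REAL bond weights (`lsum`, mirroring `AveragingDeficitTransport.lnorm`), their linearity ∕ monotonicity, and the
  domination `lnorm Y x w ≤ lsum ω x w`; the block functionals `segW`∕`loopW`∕`treeW'`∕`locW` (= `segL1`∕`loopL1`∕`treeL1'`∕`locL1` of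
  `BlockAverageDbarLinBound`∕`NE3CovariantLineSums` read on weights) and `segL1 L Y ≤ segW L ω`, `locL1 L Y ≤ locW L ω`;
* §2 ONE LEVEL: **`norm_Qbar_le_stepMaj`** — unitary `W`, `0 ≤ a`, `512(d+1)(d+4)L²a ≤ 1`, `SmallField W a`, `∀ b, ‖Y b‖ ≤ ω b` ⟹
  `‖Qbar L W Y z κ‖ ≤ stepMaj d L a ω z κ := segW L ω (L•z) κ + 16(d+1)(d+4)L²a · locW L ω (L•z) κ`;
* §3 THE TOWER: **`norm_QbarIter_le_majIter`** — unitary `W`, `0 ≤ x`, `LevelSmall d L j x`, `SmallField W x`, `∀ b, ‖Y b‖ ≤ ω b` ⟹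
  `∀ z κ, ‖QbarIter L (j+1) W Y z κ‖ ≤ majIter d L (j+1) x ω z κ`, `majIter d L (j+1) x ω = majIter d L j (prop1Radius d L x) (stepMaj d L x ω)`;
* §4 the algebra of the majorant tower used by file B: exact additivity and homogeneity in `ω` (`stepMaj_add`, `majIter_add`,
  `majIter_smul`), monotonicity (`majIter_mono`), nonnegativity, and the DUHAMEL STEP
  `majIter d L (j+1) x ω = majIter d L j x₁ (segStep L ω) + wlin d L x · majIter d L j x₁ (locStep L ω)`.

HONEST: positive-operator bookkeeping on OUR frame; nothing about minimisers, (Π-REG-γ′), Π-C-3γ′, T-E_w♯ or NE3 is asserted; NE3 NOT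
proved; spine PROVED 0∕9; finite T⁴ rung (B)+1 — NOT infinite volume, NOT mass gap, NOT BetaPertH, NOT Clay.
PLACEMENT: `Summits/QuantumFields/BalabanUV/` (cell rule: our work, not a published statement).
-/

set_option autoImplicit false

open scoped BigOperators Matrix.Norms.L2Operator
open Finset

namespace Summit.QuantumFields.BalabanUV.T4Continuum.NE3QbarIterMajorant

open Literature.MathematicalPhysics.QuantumFieldTheory.Balaban1983to89
open B7Prop1Explicit B7Prop2Explicit
open T4AveragingDeficitWall (IsUnitaryCfg SmallField)
open AveragingDeficitTransport (lnorm lnorm_nil lnorm_cons)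
open AveragingDeficitSideDeriv (loopWord)
open AveragingDeficitChartCalculus (cavg)
open AveragingDeficitTwoLevelPrep (prop1Radius)
open AveragingDeficitMultiLevelPrep (LevelSmall prop1Radius_nonneg)
open BlockAverageDbarLinBound (loopL1 treeL1' segL1)
open NE3TangentCovariantStructure (Qbar)
open NE3TangentCovariantTower (QbarIter step_small QbarIter_succ QbarIter_zero)
open NE3CovariantLineSums (Qstr locL1 norm_Qbar_sub_Qstr_le norm_Qstr_le)

noncomputable section

variable {d : ℕ}

/-! ## §1 Word weights on real bond weights -/

/-- The weight of a real bond weight `ω` along a word: `Σ_{b ⊂ Γ} ω(b)` (each letter counted once; the real-valued twin of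
`AveragingDeficitTransport.lnorm`). [folklore] -/
def lsum (ω : Site d → Fin d → ℝ) : Site d → List (Letter d) → ℝ
  | _, [] => 0
  | x, l :: w => ω (if l.2 then x else x + l.vec) l.1 + lsum ω (x + l.vec) w

/-- `lsum` of the empty word. [folklore] -/
@[simp] theorem lsum_nil (ω : Site d → Fin d → ℝ) (x : Site d) : lsum ω x [] = 0 := rfl

/-- `lsum` of a cons. [folklore] -/
@[simp] theorem lsum_cons (ω : Site d → Fin d → ℝ) (x : Site d) (l : Letter d) (w : List (Letter d)) :
    lsum ω x (l :: w) = ω (if l.2 then x else x + l.vec) l.1 + lsum ω (x + l.vec) w := rfl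

/-- `lsum` is additive in the weight. [folklore] -/
theorem lsum_add (ω₁ ω₂ : Site d → Fin d → ℝ) :
    ∀ (x : Site d) (w : List (Letter d)), lsum (fun y μ => ω₁ y μ + ω₂ y μ) x w = lsum ω₁ x w + lsum ω₂ x w
  | x, [] => by simp
  | x, l :: w => by rw [lsum_cons, lsum_cons, lsum_cons, lsum_add ω₁ ω₂ (x + l.vec) w]; ring

/-- `lsum` is homogeneous in the weight. [folklore] -/
theorem lsum_smul (c : ℝ) (ω : Site d → Fin d → ℝ) :
    ∀ (x : Site d) (w : List (Letter d)), lsum (fun y μ => c * ω y μ) x w = c * lsum ω x w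
  | x, [] => by simp
  | x, l :: w => by rw [lsum_cons, lsum_cons, lsum_smul c ω (x + l.vec) w]; ring

/-- `lsum` is monotone in the weight. [folklore] -/
theorem lsum_mono {ω₁ ω₂ : Site d → Fin d → ℝ} (h : ∀ (y : Site d) (μ : Fin d), ω₁ y μ ≤ ω₂ y μ) :
    ∀ (x : Site d) (w : List (Letter d)), lsum ω₁ x w ≤ lsum ω₂ x w
  | x, [] => le_rfl
  | x, l :: w => by rw [lsum_cons, lsum_cons]; exact add_le_add (h _ _) (lsum_mono h (x + l.vec) w)

/-- `lsum ω ≥ 0` for `ω ≥ 0`. [folklore] -/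
theorem lsum_nonneg {ω : Site d → Fin d → ℝ} (h : ∀ (y : Site d) (μ : Fin d), 0 ≤ ω y μ) :
    ∀ (x : Site d) (w : List (Letter d)), 0 ≤ lsum ω x w
  | x, [] => le_rfl
  | x, l :: w => by rw [lsum_cons]; exact add_nonneg (h _ _) (lsum_nonneg h (x + l.vec) w)

/-- A word weight against a LOCAL sup: if `ω(b) ≤ s` on the bonds starting in the `R`-ball about `q` and `|x − q|₁ + |Γ| ≤ R`, then
`lsum ω x Γ ≤ |Γ|·s` (the real twin of `BlockAverageDbarLinNorms.lnorm_le_length_mul_sup`). [folklore] -/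
theorem lsum_le_length_mul_sup (ω : Site d → Fin d → ℝ) {q : Site d} {R : ℕ} {s : ℝ}
    (hω : ∀ (x : Site d) (μ : Fin d), l1 (x - q) ≤ R → ω x μ ≤ s) :
    ∀ (w : List (Letter d)) (x : Site d), l1 (x - q) + w.length ≤ R → lsum ω x w ≤ w.length * s
  | [], x, _ => by simp
  | l :: w, x, hx => by
    rw [List.length_cons] at hx
    have hx' : l1 (x + l.vec - q) + w.length ≤ R := by
      have := l1_add_le (x - q) l.vec
      rw [l1_vec, show x - q + l.vec = x + l.vec - q by abel] at this
      omega
    have ih := lsum_le_length_mul_sup ω hω w (x + l.vec) hx'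
    rw [lsum_cons, List.length_cons, Nat.cast_succ, add_mul, one_mul, add_comm ((w.length : ℝ) * s)]
    refine add_le_add ?_ ih
    split
    · exact hω x l.1 (by omega)
    · exact hω (x + l.vec) l.1 (by omega)

/-- **DOMINATION OF WORD WEIGHTS**: `‖Y(b)‖ ≤ ω(b)` for every bond ⟹ `Σ_{b⊂Γ}‖Y(b)‖ ≤ Σ_{b⊂Γ} ω(b)`. [folklore] -/
theorem lnorm_le_lsum {n : Type*} [Fintype n] [DecidableEq n] {Y : Site d → Fin d → Matrix n n ℂ} {ω : Site d → Fin d → ℝ}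
    (h : ∀ (y : Site d) (μ : Fin d), ‖Y y μ‖ ≤ ω y μ) :
    ∀ (x : Site d) (w : List (Letter d)), lnorm Y x w ≤ lsum ω x w
  | x, [] => by simp
  | x, l :: w => by rw [lnorm_cons, lsum_cons]; exact add_le_add (h _ _) (lnorm_le_lsum h (x + l.vec) w)

/-! ### The block functionals on weights -/

/-- The block average of the straight `κ`-segment weights: `Σ_x L^{−d} Σ_{b ⊂ [x, x+Le_κ]} ω(b)` (= `segL1` read on a weight). [folklore] -/
def segW (L : ℕ) (ω : Site d → Fin d → ℝ) (q : Site d) (κ : Fin d) : ℝ :=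
  ∑ r : Fin d → Fin L, ((L : ℝ) ^ d)⁻¹ * lsum ω (q + boxVec L r) (seg κ L)

/-- The block average of the loop weights: `Σ_x L^{−d} Σ_{b ⊂ Γ_{c,x} ∪ (−Γ_c)} ω(b)` (= `loopL1` read on a weight). [folklore] -/
def loopW (L : ℕ) (ω : Site d → Fin d → ℝ) (q : Site d) (κ : Fin d) : ℝ :=
  ∑ r : Fin d → Fin L, ((L : ℝ) ^ d)⁻¹ * lsum ω q (loopWord L κ (boxVec L r))

/-- The block average of the translated tree weights read from `c₊` (= `treeL1'` read on a weight). [folklore] -/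
def treeW' (L : ℕ) (ω : Site d → Fin d → ℝ) (q : Site d) (κ : Fin d) : ℝ :=
  ∑ r : Fin d → Fin L, ((L : ℝ) ^ d)⁻¹ * lsum ω (q + (L : ℤ) • e κ) (treeWord (boxVec L r))

/-- The local `ℓ¹` functional of the one-level defect (= `NE3CovariantLineSums.locL1` read on a weight):
`1250·(loopW + ℓ_Γ) + 8·treeW' + 2·ℓ_Γ`, `ℓ_Γ = Σ_{b ⊂ [q, q + L e_κ]} ω(b)`. [folklore] -/
def locW (L : ℕ) (ω : Site d → Fin d → ℝ) (q : Site d) (κ : Fin d) : ℝ :=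
  1250 * (loopW L ω q κ + lsum ω q (seg κ L)) + 8 * treeW' L ω q κ + 2 * lsum ω q (seg κ L)

/-- `segL1 L Y ≤ segW L ω` under domination. [folklore] -/
theorem segL1_le_segW {n : Type*} [Fintype n] [DecidableEq n] (L : ℕ) {Y : Site d → Fin d → Matrix n n ℂ} {ω : Site d → Fin d → ℝ}
    (h : ∀ (y : Site d) (μ : Fin d), ‖Y y μ‖ ≤ ω y μ) (q : Site d) (κ : Fin d) : segL1 L Y q κ ≤ segW L ω q κ := by
  unfold segL1 segW
  exact Finset.sum_le_sum fun r _ => mul_le_mul_of_nonneg_left (lnorm_le_lsum h _ _) (by positivity)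

/-- `loopL1 L Y ≤ loopW L ω` under domination. [folklore] -/
theorem loopL1_le_loopW {n : Type*} [Fintype n] [DecidableEq n] (L : ℕ) {Y : Site d → Fin d → Matrix n n ℂ} {ω : Site d → Fin d → ℝ}
    (h : ∀ (y : Site d) (μ : Fin d), ‖Y y μ‖ ≤ ω y μ) (q : Site d) (κ : Fin d) : loopL1 L Y q κ ≤ loopW L ω q κ := by
  unfold loopL1 loopW
  exact Finset.sum_le_sum fun r _ => mul_le_mul_of_nonneg_left (lnorm_le_lsum h _ _) (by positivity)

/-- `treeL1' L Y ≤ treeW' L ω` under domination. [folklore] -/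
theorem treeL1'_le_treeW' {n : Type*} [Fintype n] [DecidableEq n] (L : ℕ) {Y : Site d → Fin d → Matrix n n ℂ} {ω : Site d → Fin d → ℝ}
    (h : ∀ (y : Site d) (μ : Fin d), ‖Y y μ‖ ≤ ω y μ) (q : Site d) (κ : Fin d) : treeL1' L Y q κ ≤ treeW' L ω q κ := by
  unfold treeL1' treeW'
  exact Finset.sum_le_sum fun r _ => mul_le_mul_of_nonneg_left (lnorm_le_lsum h _ _) (by positivity)

/-- `locL1 L Y ≤ locW L ω` under domination. [folklore] -/
theorem locL1_le_locW {n : Type*} [Fintype n] [DecidableEq n] (L : ℕ) {Y : Site d → Fin d → Matrix n n ℂ} {ω : Site d → Fin d → ℝ}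
    (h : ∀ (y : Site d) (μ : Fin d), ‖Y y μ‖ ≤ ω y μ) (q : Site d) (κ : Fin d) : locL1 L Y q κ ≤ locW L ω q κ := by
  unfold locL1 locW
  have h1 := loopL1_le_loopW L h q κ
  have h2 := treeL1'_le_treeW' L h q κ
  have h3 := lnorm_le_lsum h q (seg κ L)
  linarith

/-! ### Linearity, monotonicity, nonnegativity of the block functionals -/

/-- `segW` is additive in the weight. [folklore] -/
theorem segW_add (L : ℕ) (ω₁ ω₂ : Site d → Fin d → ℝ) (q : Site d) (κ : Fin d) :
    segW L (fun y μ => ω₁ y μ + ω₂ y μ) q κ = segW L ω₁ q κ + segW L ω₂ q κ := by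
  simp only [segW, lsum_add, mul_add, Finset.sum_add_distrib]

/-- `segW` is homogeneous in the weight. [folklore] -/
theorem segW_smul (L : ℕ) (c : ℝ) (ω : Site d → Fin d → ℝ) (q : Site d) (κ : Fin d) :
    segW L (fun y μ => c * ω y μ) q κ = c * segW L ω q κ := by
  simp only [segW, lsum_smul, Finset.mul_sum]
  exact Finset.sum_congr rfl fun r _ => by ring

/-- `segW` is monotone in the weight. [folklore] -/
theorem segW_mono (L : ℕ) {ω₁ ω₂ : Site d → Fin d → ℝ} (h : ∀ (y : Site d) (μ : Fin d), ω₁ y μ ≤ ω₂ y μ) (q : Site d) (κ : Fin d) :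
    segW L ω₁ q κ ≤ segW L ω₂ q κ :=
  Finset.sum_le_sum fun r _ => mul_le_mul_of_nonneg_left (lsum_mono h _ _) (by positivity)

/-- `segW ω ≥ 0` for `ω ≥ 0`. [folklore] -/
theorem segW_nonneg (L : ℕ) {ω : Site d → Fin d → ℝ} (h : ∀ (y : Site d) (μ : Fin d), 0 ≤ ω y μ) (q : Site d) (κ : Fin d) :
    0 ≤ segW L ω q κ :=
  Finset.sum_nonneg fun r _ => mul_nonneg (by positivity) (lsum_nonneg h _ _)

/-- `locW` is additive in the weight. [folklore] -/
theorem locW_add (L : ℕ) (ω₁ ω₂ : Site d → Fin d → ℝ) (q : Site d) (κ : Fin d) :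
    locW L (fun y μ => ω₁ y μ + ω₂ y μ) q κ = locW L ω₁ q κ + locW L ω₂ q κ := by
  simp only [locW, loopW, treeW', lsum_add, mul_add, Finset.sum_add_distrib]
  ring

/-- `locW` is homogeneous in the weight. [folklore] -/
theorem locW_smul (L : ℕ) (c : ℝ) (ω : Site d → Fin d → ℝ) (q : Site d) (κ : Fin d) :
    locW L (fun y μ => c * ω y μ) q κ = c * locW L ω q κ := by
  have h1 : loopW L (fun y μ => c * ω y μ) q κ = c * loopW L ω q κ := by
    simp only [loopW, lsum_smul, Finset.mul_sum]
    exact Finset.sum_congr rfl fun r _ => by ring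
  have h2 : treeW' L (fun y μ => c * ω y μ) q κ = c * treeW' L ω q κ := by
    simp only [treeW', lsum_smul, Finset.mul_sum]
    exact Finset.sum_congr rfl fun r _ => by ring
  simp only [locW, h1, h2, lsum_smul]
  ring

/-- `locW` is monotone in the weight. [folklore] -/
theorem locW_mono (L : ℕ) {ω₁ ω₂ : Site d → Fin d → ℝ} (h : ∀ (y : Site d) (μ : Fin d), ω₁ y μ ≤ ω₂ y μ) (q : Site d) (κ : Fin d) :
    locW L ω₁ q κ ≤ locW L ω₂ q κ := by
  unfold locW loopW treeW'
  have h1 : ∑ r : Fin d → Fin L, ((L : ℝ) ^ d)⁻¹ * lsum ω₁ q (loopWord L κ (boxVec L r))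
      ≤ ∑ r : Fin d → Fin L, ((L : ℝ) ^ d)⁻¹ * lsum ω₂ q (loopWord L κ (boxVec L r)) :=
    Finset.sum_le_sum fun r _ => mul_le_mul_of_nonneg_left (lsum_mono h _ _) (by positivity)
  have h2 : ∑ r : Fin d → Fin L, ((L : ℝ) ^ d)⁻¹ * lsum ω₁ (q + (L : ℤ) • e κ) (treeWord (boxVec L r))
      ≤ ∑ r : Fin d → Fin L, ((L : ℝ) ^ d)⁻¹ * lsum ω₂ (q + (L : ℤ) • e κ) (treeWord (boxVec L r)) :=
    Finset.sum_le_sum fun r _ => mul_le_mul_of_nonneg_left (lsum_mono h _ _) (by positivity)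
  have h3 := lsum_mono h q (seg κ L)
  linarith

/-- `locW ω ≥ 0` for `ω ≥ 0`. [folklore] -/
theorem locW_nonneg (L : ℕ) {ω : Site d → Fin d → ℝ} (h : ∀ (y : Site d) (μ : Fin d), 0 ≤ ω y μ) (q : Site d) (κ : Fin d) :
    0 ≤ locW L ω q κ := by
  unfold locW loopW treeW'
  have h1 : 0 ≤ ∑ r : Fin d → Fin L, ((L : ℝ) ^ d)⁻¹ * lsum ω q (loopWord L κ (boxVec L r)) :=
    Finset.sum_nonneg fun r _ => mul_nonneg (by positivity) (lsum_nonneg h _ _)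
  have h2 : 0 ≤ ∑ r : Fin d → Fin L, ((L : ℝ) ^ d)⁻¹ * lsum ω (q + (L : ℤ) • e κ) (treeWord (boxVec L r)) :=
    Finset.sum_nonneg fun r _ => mul_nonneg (by positivity) (lsum_nonneg h _ _)
  have h3 := lsum_nonneg h q (seg κ L)
  positivity

/-! ## §2 One level: `‖Qbar‖ ≤ segW + 16(d+1)(d+4)L²a · locW` -/

/-- The one-level relative defect `wlin d L x = 16(d+1)(d+4)L²x` (the `w`-ball radius of the loop variables at small-field radius `x`,
`NE3CovariantLineSums.norm_Wcx_sub_one_le_wBall`). [folklore] -/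
def wlin (d L : ℕ) (x : ℝ) : ℝ := 16 * (d + 1) * (d + 4) * (L : ℝ) ^ 2 * x

/-- `0 ≤ wlin d L x` for `x ≥ 0`. [folklore] -/
theorem wlin_nonneg (d L : ℕ) {x : ℝ} (hx : 0 ≤ x) : 0 ≤ wlin d L x := by unfold wlin; positivity

/-- THE STRAIGHT STEP on weights, read on the coarse unit lattice: `segStep L ω (z,κ) := segW L ω (L•z) κ`. [folklore] -/
def segStep (L : ℕ) (ω : Site d → Fin d → ℝ) : Site d → Fin d → ℝ := fun z κ => segW L ω ((L : ℤ) • z) κ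

/-- THE LOCAL DEFECT STEP on weights, read on the coarse unit lattice: `locStep L ω (z,κ) := locW L ω (L•z) κ`. [folklore] -/
def locStep (L : ℕ) (ω : Site d → Fin d → ℝ) : Site d → Fin d → ℝ := fun z κ => locW L ω ((L : ℤ) • z) κ

/-- THE ONE-LEVEL MAJORANT STEP: `stepMaj d L x ω (z,κ) := segW L ω (L•z) κ + wlin d L x · locW L ω (L•z) κ`. [folklore] -/
def stepMaj (d L : ℕ) (x : ℝ) (ω : Site d → Fin d → ℝ) : Site d → Fin d → ℝ :=
  fun z κ => segStep L ω z κ + wlin d L x * locStep L ω z κ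

/-- `stepMaj` unfolded. [folklore] -/
theorem stepMaj_apply (d L : ℕ) (x : ℝ) (ω : Site d → Fin d → ℝ) (z : Site d) (κ : Fin d) :
    stepMaj d L x ω z κ = segW L ω ((L : ℤ) • z) κ + wlin d L x * locW L ω ((L : ℤ) • z) κ := rfl

/-- **ONE LEVEL — THE LINEARISED DOUBLE-BAR AVERAGE IS DOMINATED BY THE MAJORANT STEP**: for unitary `W` with `SmallField W a`,
`0 ≤ a`, `512(d+1)(d+4)L²a ≤ 1`, and any real bond weight `ω` with `‖Y(b)‖ ≤ ω(b)` for every bond,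
`‖Qbar L W Y z κ‖ ≤ segW L ω (L•z) κ + 16(d+1)(d+4)L²a · locW L ω (L•z) κ`
(`‖Qstr‖ ≤ segL1 ≤ segW` — the transports are isometries — and `‖Qbar − Qstr‖ ≤ 16(d+1)(d+4)L²a·locL1 ≤ (same)·locW`). [folklore] -/
theorem norm_Qbar_le_stepMaj {n : Type*} [Fintype n] [DecidableEq n] [Nonempty n] {L : ℕ} (hL : 1 ≤ L) {W : Site d → Fin d → (Matrix n n ℂ)ˣ} (hWu : IsUnitaryCfg W)
    {a : ℝ} (ha : 0 ≤ a) (hsmall : 512 * (d + 1) * (d + 4) * (L : ℝ) ^ 2 * a ≤ 1) (hWa : SmallField W a)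
    {Y : Site d → Fin d → Matrix n n ℂ} {ω : Site d → Fin d → ℝ} (hdom : ∀ (y : Site d) (μ : Fin d), ‖Y y μ‖ ≤ ω y μ)
    (z : Site d) (κ : Fin d) : ‖Qbar L W Y z κ‖ ≤ stepMaj d L a ω z κ := by
  have h1 := norm_Qbar_sub_Qstr_le hL hWu ha hsmall hWa Y z κ
  have h2 := norm_Qstr_le hL hWu ha hsmall hWa Y z κ
  have h3 := segL1_le_segW L hdom ((L : ℤ) • z) κ
  have h4 := locL1_le_locW L hdom ((L : ℤ) • z) κ
  have hw : 0 ≤ 16 * (d + 1) * (d + 4) * (L : ℝ) ^ 2 * a := by positivity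
  rw [stepMaj_apply]
  calc ‖Qbar L W Y z κ‖ ≤ ‖Qstr L W Y z κ‖ + ‖Qbar L W Y z κ - Qstr L W Y z κ‖ := norm_le_insert' _ _
    _ ≤ segW L ω ((L : ℤ) • z) κ + (16 * (d + 1) * (d + 4) * (L : ℝ) ^ 2 * a) * locW L ω ((L : ℤ) • z) κ :=
        add_le_add (h2.trans h3) (h1.trans (mul_le_mul_of_nonneg_left h4 hw))
    _ = _ := by rfl

/-! ## §3 The tower: `‖QbarIter L (j+1) W Y‖ ≤ majIter d L (j+1) x ω` -/

/-- THE MAJORANT TOWER (inner-first, like `QbarIter`): `majIter d L 0 x ω = ω`,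
`majIter d L (j+1) x ω = majIter d L j (prop1Radius d L x) (stepMaj d L x ω)` — the ordered product of the positive operators
`segStep L + wlin d L xᵢ · locStep L` along the radii `xᵢ = (prop1Radius d L)^[i] x` of the multi-level class. [folklore] -/
def majIter (d L : ℕ) : ℕ → ℝ → (Site d → Fin d → ℝ) → Site d → Fin d → ℝ
  | 0, _, ω => ω
  | j + 1, x, ω => majIter d L j (prop1Radius d L x) (stepMaj d L x ω)

/-- `majIter d L 0 x ω = ω`. [folklore] -/
@[simp] theorem majIter_zero (d L : ℕ) (x : ℝ) (ω : Site d → Fin d → ℝ) : majIter d L 0 x ω = ω := rfl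

/-- `majIter d L (j+1) x ω = majIter d L j (prop1Radius d L x) (stepMaj d L x ω)`. [folklore] -/
theorem majIter_succ (d L j : ℕ) (x : ℝ) (ω : Site d → Fin d → ℝ) :
    majIter d L (j + 1) x ω = majIter d L j (prop1Radius d L x) (stepMaj d L x ω) := rfl

/-- `majIter d L 1 x ω = stepMaj d L x ω`. [folklore] -/
theorem majIter_one (d L : ℕ) (x : ℝ) (ω : Site d → Fin d → ℝ) : majIter d L 1 x ω = stepMaj d L x ω := rfl

/-- **THE TOWER — THE k-FOLD LINEARISED DOUBLE-BAR AVERAGE IS DOMINATED BY THE MAJORANT TOWER**: in the multi-level small-field class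
(unitary `W`, `0 ≤ x`, `LevelSmall d L j x`, `SmallField W x`), for every real bond weight `ω` with `‖Y(b)‖ ≤ ω(b)` on every bond,
`‖QbarIter L (j+1) W Y z κ‖ ≤ majIter d L (j+1) x ω z κ` at every coarse bond — EXACT POSITIVITY, no constant: induction over
`QbarIter_succ` (finest level first) with §2 at each level and `step_small` for the next level's class. [folklore] -/
theorem norm_QbarIter_le_majIter {n : Type*} [Fintype n] [DecidableEq n] [Nonempty n] {L : ℕ} (hL : 1 ≤ L) (j : ℕ) :
    ∀ {W : Site d → Fin d → (Matrix n n ℂ)ˣ} {x : ℝ}, IsUnitaryCfg W → 0 ≤ x → LevelSmall d L j x → SmallField W x →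
    ∀ {Y : Site d → Fin d → Matrix n n ℂ} {ω : Site d → Fin d → ℝ}, (∀ (y : Site d) (μ : Fin d), ‖Y y μ‖ ≤ ω y μ) →
      ∀ (z : Site d) (κ : Fin d), ‖QbarIter L (j + 1) W Y z κ‖ ≤ majIter d L (j + 1) x ω z κ := by
  induction j with
  | zero =>
      intro W x hWu hx hsm hWx Y ω hdom z κ
      obtain ⟨h512, -, -, -⟩ := step_small hL hWu hx hsm hWx
      rw [zero_add, QbarIter_succ, QbarIter_zero, majIter_one]
      exact norm_Qbar_le_stepMaj hL hWu hx h512 hWx hdom z κ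
  | succ j ih =>
      intro W x hWu hx hsm hWx Y ω hdom z κ
      obtain ⟨h512, hW₁u, hr0, hW₁x⟩ := step_small hL hWu hx hsm.1 hWx
      rw [QbarIter_succ, majIter_succ]
      exact ih hW₁u hr0 hsm.2 hW₁x (fun y μ => norm_Qbar_le_stepMaj hL hWu hx h512 hWx hdom y μ) z κ

/-! ## §4 The algebra of the majorant tower (for the two-tier evaluation of file B) -/

/-- `stepMaj` is additive in the weight. [folklore] -/
theorem stepMaj_add (d L : ℕ) (x : ℝ) (ω₁ ω₂ : Site d → Fin d → ℝ) :
    stepMaj d L x (fun y μ => ω₁ y μ + ω₂ y μ) = fun z κ => stepMaj d L x ω₁ z κ + stepMaj d L x ω₂ z κ := by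
  funext z κ
  simp only [stepMaj, segStep, locStep, segW_add, locW_add]
  ring

/-- `stepMaj` is homogeneous in the weight. [folklore] -/
theorem stepMaj_smul (d L : ℕ) (x c : ℝ) (ω : Site d → Fin d → ℝ) :
    stepMaj d L x (fun y μ => c * ω y μ) = fun z κ => c * stepMaj d L x ω z κ := by
  funext z κ
  simp only [stepMaj, segStep, locStep, segW_smul, locW_smul]
  ring

/-- `stepMaj` is monotone in the weight (for `x ≥ 0`). [folklore] -/
theorem stepMaj_mono (d L : ℕ) {x : ℝ} (hx : 0 ≤ x) {ω₁ ω₂ : Site d → Fin d → ℝ}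
    (h : ∀ (y : Site d) (μ : Fin d), ω₁ y μ ≤ ω₂ y μ) (z : Site d) (κ : Fin d) : stepMaj d L x ω₁ z κ ≤ stepMaj d L x ω₂ z κ := by
  simp only [stepMaj, segStep, locStep]
  exact add_le_add (segW_mono L h _ _) (mul_le_mul_of_nonneg_left (locW_mono L h _ _) (wlin_nonneg d L hx))

/-- `stepMaj ω ≥ 0` for `ω ≥ 0`, `x ≥ 0`. [folklore] -/
theorem stepMaj_nonneg (d L : ℕ) {x : ℝ} (hx : 0 ≤ x) {ω : Site d → Fin d → ℝ}
    (h : ∀ (y : Site d) (μ : Fin d), 0 ≤ ω y μ) (z : Site d) (κ : Fin d) : 0 ≤ stepMaj d L x ω z κ := by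
  simp only [stepMaj, segStep, locStep]
  exact add_nonneg (segW_nonneg L h _ _) (mul_nonneg (wlin_nonneg d L hx) (locW_nonneg L h _ _))

/-- The step is the straight step plus `wlin x` times the local defect step (pointwise). [folklore] -/
theorem stepMaj_eq_add (d L : ℕ) (x : ℝ) (ω : Site d → Fin d → ℝ) :
    stepMaj d L x ω = fun z κ => segStep L ω z κ + (fun z' κ' => wlin d L x * locStep L ω z' κ') z κ := rfl

/-- **THE MAJORANT TOWER IS ADDITIVE** in the weight. [folklore] -/
theorem majIter_add (d L : ℕ) : ∀ (j : ℕ) (x : ℝ) (ω₁ ω₂ : Site d → Fin d → ℝ),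
    majIter d L j x (fun y μ => ω₁ y μ + ω₂ y μ) = fun z κ => majIter d L j x ω₁ z κ + majIter d L j x ω₂ z κ
  | 0, _, _, _ => rfl
  | j + 1, x, ω₁, ω₂ => by
      rw [majIter_succ, majIter_succ, majIter_succ, stepMaj_add]
      exact majIter_add d L j (prop1Radius d L x) _ _

/-- **THE MAJORANT TOWER IS HOMOGENEOUS** in the weight. [folklore] -/
theorem majIter_smul (d L : ℕ) : ∀ (j : ℕ) (x c : ℝ) (ω : Site d → Fin d → ℝ),
    majIter d L j x (fun y μ => c * ω y μ) = fun z κ => c * majIter d L j x ω z κ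
  | 0, _, _, _ => rfl
  | j + 1, x, c, ω => by
      rw [majIter_succ, majIter_succ, stepMaj_smul]
      exact majIter_smul d L j (prop1Radius d L x) c _

/-- **THE MAJORANT TOWER IS MONOTONE** in the weight (for `x ≥ 0`). [folklore] -/
theorem majIter_mono (d L : ℕ) : ∀ (j : ℕ) {x : ℝ}, 0 ≤ x → ∀ {ω₁ ω₂ : Site d → Fin d → ℝ},
    (∀ (y : Site d) (μ : Fin d), ω₁ y μ ≤ ω₂ y μ) → ∀ (z : Site d) (κ : Fin d), majIter d L j x ω₁ z κ ≤ majIter d L j x ω₂ z κ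
  | 0, _, _, _, _, h, z, κ => h z κ
  | j + 1, x, hx, ω₁, ω₂, h, z, κ => by
      rw [majIter_succ, majIter_succ]
      exact majIter_mono d L j (prop1Radius_nonneg hx) (stepMaj_mono d L hx h) z κ

/-- `majIter ω ≥ 0` for `ω ≥ 0`, `x ≥ 0`. [folklore] -/
theorem majIter_nonneg (d L : ℕ) : ∀ (j : ℕ) {x : ℝ}, 0 ≤ x → ∀ {ω : Site d → Fin d → ℝ},
    (∀ (y : Site d) (μ : Fin d), 0 ≤ ω y μ) → ∀ (z : Site d) (κ : Fin d), 0 ≤ majIter d L j x ω z κ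
  | 0, _, _, _, h, z, κ => h z κ
  | j + 1, x, hx, ω, h, z, κ => by
      rw [majIter_succ]
      exact majIter_nonneg d L j (prop1Radius_nonneg hx) (stepMaj_nonneg d L hx h) z κ

/-- **THE DUHAMEL STEP OF THE MAJORANT TOWER**: peeling the finest level,
`majIter d L (j+1) x ω = majIter d L j x₁ (segStep L ω) + wlin d L x · majIter d L j x₁ (locStep L ω)`, `x₁ = prop1Radius d L x`
(exact additivity and homogeneity of the tower).  File B iterates this on the straight part and reads every defect term DIRECTLY from
its birth level. [folklore] -/
theorem majIter_succ_eq_duhamel (d L j : ℕ) (x : ℝ) (ω : Site d → Fin d → ℝ) :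
    majIter d L (j + 1) x ω = fun z κ => majIter d L j (prop1Radius d L x) (segStep L ω) z κ
      + wlin d L x * majIter d L j (prop1Radius d L x) (locStep L ω) z κ := by
  rw [majIter_succ, stepMaj_eq_add, majIter_add, majIter_smul]

end

end Summit.QuantumFields.BalabanUV.T4Continuum.NE3QbarIterMajorant
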